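import Mathlib
import Summits.ValiantsHypothesis.ValiantsHypothesis.Theses.NewtonUnitEquations
import Summits.ValiantsHypothesis.ValiantsHypothesis.Theses.NewtonFrames
import Literature.Computability.AlgebraicComplexity.NewtonPolygonTauTransfer

/-!
# Sketch (crux-ideate, round 1, ideator 3) — crux `DissociatedFixedK` (stmt-ValiantsHypothesis-5907)

First lemmas of this ideator's crux idea cards, stated over existing declarations; `lean check` rc 0.
Nothing here is an item.  `sorry` marks the statements that are only CLAIMED (the cards say which);
everything else is proved.  Namespace private to this sketch.

* Card `subproduct-vertex-shift` (main): `SumsetVertexBound` (the k = 1 statement the count reduces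
  to; = NewtonFrames.ShallowChains at C = ∅, `sumsetVertexBound_of_shallowChains` PROVED),
  `strictMax_sum` + `sum_mem_extremePoints_sumset` (the additive half of the lever, PROVED),
  `aliveFrame`, `vertexShift` (FIRST LEMMA, claimed).
* Card `annihilator-product-functional`: `productFunctional_rankOne` (the lever, PROVED),
  `exists_annihilator` + `thickness_of_annihilator` (FIRST LEMMA = thickness ≤ k-1 with dead letters,
  PROVED, induction- and division-free), `pivot_letter` (count sharpening, PROVED).
* Appendix B (not filed): `FullSupportFixedK`, `chain_cube_lemma` (PROVED), `extremePoints_union_subset` (PROVED).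
* Shared planar wrapper: `exists_strict_direction` (strict exposure + generic perturbation, PROVED with helpers
  `exists_vec_of_clm`, `exists_strict_sep`, `exists_inj_dir`), `coeff_sum_prod_of_injective` + `support_sum_prod_subset`
  (blueprint step 1, PROVED with `prod_eq_sum_monomial`, `coeff_prod_of_injective`).  ONLY `vertexShift` remains `sorry`.
-/

namespace Summit.ValiantsHypothesis.ValiantsHypothesis.Cruxes.DissociatedFixedK.Ideator3

open scoped BigOperators
open Finset Matrix Literature.Computability.AlgebraicComplexity Literature.Computability.AlgebraicComplexity.KPTT

noncomputable section

/-! ## Card C — subproduct vertex shift (main card) -/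

/-- The `k = 1`, coefficient-free statement the card reduces to: the convex hull of a SUMSET of `m`
planar `t`-sets has `poly(m, t)` vertices (Ostrowski: Newton polygon of a product = Minkowski sum;
a Minkowski sum of `m` convex polygons with `≤ t` vertices each has `≤ m t` vertices).  Verbatim the
`C = ∅` instance of the sibling route's crux `NewtonFrames.ShallowChains`. -/
def SumsetVertexBound : Prop :=
  ∃ c : ℕ, ∀ (m t : ℕ) (A : Fin m → Finset (Fin 2 →₀ ℕ)), (∀ j, (A j).card ≤ t) →
    (Set.extremePoints ℝ (convexHull ℝ ((fun e : Fin 2 →₀ ℕ => fun i : Fin 2 => ((e i : ℕ) : ℝ)) ''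
      (((Fintype.piFinset A).image (fun a => ∑ j, a j) : Finset (Fin 2 →₀ ℕ)) :
        Set (Fin 2 →₀ ℕ))))).ncard ≤ (m + t + 2) ^ c

/-- `ShallowChains` (NewtonFrames, rank 4) with `C = ∅` is `SumsetVertexBound`: the support item is
shared with the sibling route by implication. -/
theorem sumsetVertexBound_of_shallowChains
    (h : Summit.ValiantsHypothesis.ValiantsHypothesis.Theses.NewtonFrames.ShallowChains) :
    SumsetVertexBound := by
  obtain ⟨c, hc⟩ := h
  refine ⟨c, fun m t A hA => ?_⟩
  have := hc m t A ∅ hA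
  simpa using this

/-- THE LEVER's additive half: strict maximisers add up.  If `b j` is the strict `ℓ`-maximum of
`C j` for every `j`, then `Σ_j b j` is the strict `ℓ`-maximum of the sumset. (With the tree's
`mem_extremePoints_convexHull_of_linear` this makes the shifted-back point a vertex of the
sub-product's Newton polygon.) -/
theorem strictMax_sum {m : ℕ} {E : Type*} [AddCommGroup E] [Module ℝ E]
    (C : Fin m → Finset E) (ℓ : E →ₗ[ℝ] ℝ) (b : Fin m → E)
    (hmax : ∀ j, ∀ q ∈ C j, q ≠ b j → ℓ q < ℓ (b j))
    (a : Fin m → E) (ha : ∀ j, a j ∈ C j) (hne : a ≠ b) :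
    ℓ (∑ j, a j) < ℓ (∑ j, b j) := by
  rw [map_sum, map_sum]
  have hle : ∀ j, ℓ (a j) ≤ ℓ (b j) := by
    intro j
    by_cases h : a j = b j
    · rw [h]
    · exact (hmax j (a j) (ha j) h).le
  obtain ⟨j₀, hj₀⟩ : ∃ j, a j ≠ b j := by
    by_contra h
    push Not at h
    exact hne (funext h)
  exact Finset.sum_lt_sum (fun j _ => hle j) ⟨j₀, Finset.mem_univ _, hmax j₀ (a j₀) (ha j₀) hj₀⟩

/-- Consequently the sum of strict maximisers is a vertex of the hull of the sumset
(`mem_extremePoints_convexHull_of_linear` from the tree). -/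
theorem sum_mem_extremePoints_sumset {m : ℕ} (C : Fin m → Finset (Fin 2 → ℝ))
    (ℓ : (Fin 2 → ℝ) →ₗ[ℝ] ℝ) (b : Fin m → (Fin 2 → ℝ)) (hb : ∀ j, b j ∈ C j)
    (hmax : ∀ j, ∀ q ∈ C j, q ≠ b j → ℓ q < ℓ (b j)) :
    (∑ j, b j) ∈ Set.extremePoints ℝ (convexHull ℝ
      (((Fintype.piFinset C).image (fun a => ∑ j, a j) : Finset (Fin 2 → ℝ)) : Set (Fin 2 → ℝ))) := by
  apply mem_extremePoints_convexHull_of_linear (l := ℓ)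
  · simp only [Finset.coe_image, Set.mem_image, Finset.mem_coe, Fintype.mem_piFinset]
    exact ⟨b, hb, rfl⟩
  · intro q hq hqb
    simp only [Finset.coe_image, Set.mem_image, Finset.mem_coe, Fintype.mem_piFinset] at hq
    obtain ⟨a, ha, rfl⟩ := hq
    have hne : a ≠ b := by rintro rfl; exact hqb rfl
    exact strictMax_sum C ℓ b hmax a ha hne

/-- The alive sub-frame of a pattern `I`: letters of `A j` alive in every product `i ∈ I`. -/
def aliveFrame {k m : ℕ} (A : Fin m → Finset (Fin 2 →₀ ℕ))
    (f : Fin k → Fin m → MvPolynomial (Fin 2) ℂ) (I : Finset (Fin k)) (j : Fin m) :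
    Finset (Fin 2 →₀ ℕ) :=
  (A j).filter fun e => ∀ i ∈ I, e ∈ (f i j).support

/-- FIRST LEMMA of card C (vertex shift; claimed): every vertex `p` of `Newt(Σ_i Π_j f_ij)` on a
dissociated frame is `q + Σ_{j∈J} α_j` with `|J| ≤ k-1` re-chosen letters `α_j ∈ A_j` and `q` a
VERTEX of the hull of the sumset of the alive sub-frame `(aliveFrame A f I j)_{j ∉ J}` — i.e. a vertex
of the Newton polygon of ONE product of indicator polynomials.  (Thickness = Disproof §A
`mixed_cube_lemma`; `q` is a vertex by `sum_mem_extremePoints_sumset` for a generic exposing `ℓ`.) -/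
theorem vertexShift {k m t : ℕ} (A : Fin m → Finset (Fin 2 →₀ ℕ))
    (f : Fin k → Fin m → MvPolynomial (Fin 2) ℂ)
    (hA : ∀ j, (A j).card ≤ t) (hf : ∀ i j, (f i j).support ⊆ A j)
    (hinj : ∀ a b : Fin m → (Fin 2 →₀ ℕ), (∀ j, a j ∈ A j) → (∀ j, b j ∈ A j) →
      ∑ j, a j = ∑ j, b j → a = b)
    (p : Fin 2 → ℝ)
    (hp : p ∈ Set.extremePoints ℝ (convexHull ℝ (toPt '' ((∑ i, ∏ j, f i j).support : Set (Fin 2 →₀ ℕ))))) :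
    ∃ (I : Finset (Fin k)) (J : Finset (Fin m)) (α : Fin m → (Fin 2 →₀ ℕ)) (q : Fin 2 → ℝ),
      J.card + 1 ≤ k ∧ (∀ j ∈ J, α j ∈ A j) ∧
      q ∈ Set.extremePoints ℝ (convexHull ℝ (toPt ''
        (((Fintype.piFinset fun j : {j // j ∉ J} => aliveFrame A f I j.1).image
          (fun a => ∑ j, a j) : Finset (Fin 2 →₀ ℕ)) : Set (Fin 2 →₀ ℕ)))) ∧
      p = q + ∑ j ∈ J, toPt (α j) := by
  sorry


/-! ## Card A — annihilating product functional -/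

/-- THE LEVER of card A: the product functional `Λ_λ(h) = Σ_y (Π_j λ_j(y_j)) h(y)` on functions of
the Boolean cube factors on a rank-one function: `Λ_λ(⊗ ψ_j) = Π_j (λ_j(0)ψ_j(0) + λ_j(1)ψ_j(1))`. -/
theorem productFunctional_rankOne {J : Type*} [Fintype J] [DecidableEq J]
    (lam ψ : J → Bool → ℂ) :
    ∑ y : J → Bool, (∏ j, lam j (y j)) * ∏ j, ψ j (y j)
      = ∏ j, (lam j false * ψ j false + lam j true * ψ j true) := by
  have h := Finset.prod_univ_sum (fun _ : J => (Finset.univ : Finset Bool))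
    (fun j b => lam j b * ψ j b)
  simp only [Fintype.piFinset_univ] at h
  have h' : ∀ j : J, (∑ b : Bool, lam j b * ψ j b) = lam j false * ψ j false + lam j true * ψ j true := by
    intro j
    rw [Fintype.sum_bool]
    ring
  simp only [h'] at h
  rw [h]
  refine Finset.sum_congr rfl fun y _ => ?_
  rw [← Finset.prod_mul_distrib]

/-- Existence of the annihilating product functional. -/
theorem exists_annihilator {k : ℕ} {J : Type*} [Fintype J] [DecidableEq J]
    (x : Fin k → ℂ) (φ : Fin k → J → Bool → ℂ)
    (hstruct : ∀ i, x i = 0 ∨ (∀ j, φ i j false ≠ 0) ∨ (∃ j, φ i j true = 0))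
    (hk : k ≤ Fintype.card J) :
    ∃ lam : J → Bool → ℂ, (∀ j, lam j true ≠ 0) ∧
      ∀ i, x i = 0 ∨ ∃ j, lam j false * φ i j false + lam j true * φ i j true = 0 := by
  classical
  rcases isEmpty_or_nonempty J with hJ | hJ
  · refine ⟨fun _ _ => 1, fun j => one_ne_zero, fun i => ?_⟩
    have : Fintype.card J = 0 := Fintype.card_eq_zero
    exact absurd i.2 (by omega)
  -- dead terms and a dead coordinate for each
  let dead : Finset (Fin k) := Finset.univ.filter fun i => x i ≠ 0 ∧ ∃ j, φ i j true = 0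
  have hdead : ∀ i ∈ dead, ∃ j, φ i j true = 0 := fun i hi => (Finset.mem_filter.1 hi).2.2
  choose! jd hjd using hdead
  let D : Finset J := dead.image jd
  let alive : Finset (Fin k) := Finset.univ.filter fun i => x i ≠ 0 ∧ ∀ j, φ i j true ≠ 0
  have halive_false : ∀ i ∈ alive, ∀ j, φ i j false ≠ 0 := by
    intro i hi j
    have hi' := (Finset.mem_filter.1 hi).2
    rcases hstruct i with h0 | hf | ⟨j', hj'⟩
    · exact absurd h0 hi'.1
    · exact hf j
    · exact absurd hj' (hi'.2 j')
  have hdisj : Disjoint alive dead := by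
    rw [Finset.disjoint_left]
    intro i h1 h2
    obtain ⟨j, hj⟩ := (Finset.mem_filter.1 h2).2.2
    exact (Finset.mem_filter.1 h1).2.2 j hj
  have hcard1 : alive.card + dead.card ≤ k := by
    rw [← Finset.card_union_of_disjoint hdisj]
    exact (Finset.card_le_univ _).trans (by simp)
  have hD : D.card ≤ dead.card := Finset.card_image_le
  have hDJ : D.card ≤ Fintype.card J := (Finset.card_le_univ D)
  have hcard2 : alive.card ≤ Fintype.card J - D.card := by omega
  -- an embedding of the alive terms into the non-dead coordinates
  have hemb : Nonempty (alive ↪ (Finset.univ \ D : Finset J)) := by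
    apply Function.Embedding.nonempty_of_card_le
    rw [Fintype.card_coe, Fintype.card_coe, Finset.card_sdiff_of_subset (Finset.subset_univ D),
      Finset.card_univ]
    exact hcard2
  obtain ⟨e⟩ := hemb
  have key : ∀ (a : alive)
      (h : ∃ a' : alive, ((e a' : (Finset.univ \ D : Finset J)) : J) = ((e a : (Finset.univ \ D : Finset J)) : J)),
      h.choose = a := by
    intro a h
    exact e.injective (Subtype.ext h.choose_spec)
  have heD : ∀ a : alive, ((e a : (Finset.univ \ D : Finset J)) : J) ∉ D :=
    fun a => (Finset.mem_sdiff.1 (e a).2).2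
  -- the functional's factors, with their three evaluation rules
  obtain ⟨lam, hlamD, hlamA, hlamO⟩ : ∃ lam : J → Bool → ℂ,
      (∀ j ∈ D, lam j = fun b => cond b 1 0) ∧
      (∀ a : alive, lam ((e a : (Finset.univ \ D : Finset J)) : J)
        = fun b => cond b (-(φ (a : Fin k) ((e a : (Finset.univ \ D : Finset J)) : J) false))
            (φ (a : Fin k) ((e a : (Finset.univ \ D : Finset J)) : J) true)) ∧
      (∀ j ∉ D, (¬ ∃ a : alive, ((e a : (Finset.univ \ D : Finset J)) : J) = j) →
        lam j = fun b => cond b 1 0) := by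
    refine ⟨fun j => if hj : j ∈ D then (fun b => cond b 1 0)
      else if h : ∃ a : alive, ((e a : (Finset.univ \ D : Finset J)) : J) = j then
        (fun b => cond b (-(φ (h.choose : Fin k) j false)) (φ (h.choose : Fin k) j true))
      else (fun b => cond b 1 0), ?_, ?_, ?_⟩
    · intro j hj
      simp only [dif_pos hj]
    · intro a
      have h : ∃ a' : alive, ((e a' : (Finset.univ \ D : Finset J)) : J)
          = ((e a : (Finset.univ \ D : Finset J)) : J) := ⟨a, rfl⟩
      simp only [dif_neg (heD a), dif_pos h]
      rw [key a h]
    · intro j hj hne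
      simp only [dif_neg hj, dif_neg hne]
  refine ⟨lam, ?_, ?_⟩
  · intro j
    by_cases hjD : j ∈ D
    · rw [hlamD j hjD]; exact one_ne_zero
    · by_cases h : ∃ a : alive, ((e a : (Finset.univ \ D : Finset J)) : J) = j
      · obtain ⟨a, rfl⟩ := h
        rw [hlamA a]
        exact neg_ne_zero.2 (halive_false _ a.2 _)
      · rw [hlamO j hjD h]; exact one_ne_zero
  · intro i
    by_cases hx : x i = 0
    · exact Or.inl hx
    right
    by_cases hdi : ∃ j, φ i j true = 0
    · -- dead term: its chosen coordinate lies in D and λ = (0,1) there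
      have hi : i ∈ dead := Finset.mem_filter.2 ⟨Finset.mem_univ _, hx, hdi⟩
      refine ⟨jd i, ?_⟩
      have hjD : jd i ∈ D := Finset.mem_image_of_mem jd hi
      rw [hlamD _ hjD, hjd i hi]
      simp
    · -- alive term: use the coordinate e ⟨i, _⟩
      push Not at hdi
      have hi : i ∈ alive := Finset.mem_filter.2 ⟨Finset.mem_univ _, hx, hdi⟩
      refine ⟨((e ⟨i, hi⟩ : (Finset.univ \ D : Finset J)) : J), ?_⟩
      rw [hlamA ⟨i, hi⟩]
      simp only [cond_true, cond_false]
      ring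

/-- FIRST LEMMA of card A (dual-witness thickness on the two-letter subcube).  `x i` = value of
term `i` outside the deviation coordinates `J`, `φ i j false` = coefficient of `f i j` at the
box-top letter `a^I_j`, `φ i j true` = coefficient at the survivor's letter `b_j`.  Structure
hypothesis: every term that matters is alive at the `0`-corner (terms alive at `b`) or dead at the
`1`-corner in some coordinate (terms dead at `b`).  All other cube points are cancelled (they are
`w`-higher than the top survivor `b`), `b` itself survives; conclusion: `|J| ≤ k - 1`.
Proof = choose `λ_j = (0,1)` on the dead coordinates and `λ_{ι i} = (φ i _ true, -φ i _ false)` along an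
injection `ι` of the alive terms into the remaining coordinates; `Λ_λ` kills every term by
`productFunctional_rankOne` yet `Λ_λ(g) = (Π_j λ_j 1) · g(𝟙) ≠ 0`. -/
theorem thickness_of_annihilator {k : ℕ} {J : Type*} [Fintype J] [DecidableEq J]
    (x : Fin k → ℂ) (φ : Fin k → J → Bool → ℂ)
    (hstruct : ∀ i, x i = 0 ∨ (∀ j, φ i j false ≠ 0) ∨ (∃ j, φ i j true = 0))
    (hzero : ∀ y : J → Bool, y ≠ (fun _ => true) → ∑ i, x i * ∏ j, φ i j (y j) = 0)
    (htop : ∑ i, x i * ∏ j, φ i j true ≠ 0) :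
    Fintype.card J < k := by
  classical
  by_contra hk
  push Not at hk
  obtain ⟨lam, hlam1, hlam2⟩ := exists_annihilator x φ hstruct hk
  -- the functional applied to g, computed two ways
  let g : (J → Bool) → ℂ := fun y => ∑ i, x i * ∏ j, φ i j (y j)
  have way1 : ∑ y : J → Bool, (∏ j, lam j (y j)) * g y = (∏ j, lam j true) * g (fun _ => true) := by
    rw [Finset.sum_eq_single (fun _ => true)]
    · intro y _ hy
      rw [show g y = 0 from hzero y hy, mul_zero]
    · intro h; exact absurd (Finset.mem_univ _) h
  have way2 : ∑ y : J → Bool, (∏ j, lam j (y j)) * g y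
      = ∑ i, x i * ∏ j, (lam j false * φ i j false + lam j true * φ i j true) := by
    have : ∀ y : J → Bool, (∏ j, lam j (y j)) * g y
        = ∑ i, x i * ((∏ j, lam j (y j)) * ∏ j, φ i j (y j)) := by
      intro y
      simp only [g, Finset.mul_sum]
      refine Finset.sum_congr rfl fun i _ => ?_
      ring
    simp only [this]
    rw [Finset.sum_comm]
    refine Finset.sum_congr rfl fun i _ => ?_
    rw [← Finset.mul_sum, productFunctional_rankOne]
  have hvan : ∑ i, x i * ∏ j, (lam j false * φ i j false + lam j true * φ i j true) = 0 := by
    refine Finset.sum_eq_zero fun i _ => ?_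
    rcases hlam2 i with h0 | ⟨j, hj⟩
    · rw [h0, zero_mul]
    · rw [Finset.prod_eq_zero (Finset.mem_univ j) hj, mul_zero]
  have hprod : (∏ j, lam j true) ≠ 0 := Finset.prod_ne_zero_iff.2 fun j _ => hlam1 j
  have : (∏ j, lam j true) * g (fun _ => true) = 0 := by rw [← way1, way2, hvan]
  rcases mul_eq_zero.1 this with h | h
  · exact hprod h
  · exact htop h


/-- COUNT SHARPENING of card A (pivot letters): along a coordinate line through the top survivor
the tensor is a fixed linear functional `ξ` of the coefficient column, so the survivor's letter
`β` has a coefficient column outside the span of the columns of the `w`-higher letters. -/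
theorem pivot_letter {k : ℕ} {ι : Type*} (ξ : Fin k → ℂ) (c : ι → Fin k → ℂ)
    (above : Finset ι) (β : ι)
    (hzero : ∀ α ∈ above, ∑ i, ξ i * c α i = 0) (hne : ∑ i, ξ i * c β i ≠ 0) :
    c β ∉ Submodule.span ℂ (c '' (above : Set ι)) := by
  intro hmem
  -- the functional `v ↦ Σ ξ_i v_i` vanishes on the span of the higher columns
  let L : (Fin k → ℂ) →ₗ[ℂ] ℂ :=
    { toFun := fun v => ∑ i, ξ i * v i
      map_add' := by intro v w; simp [mul_add, Finset.sum_add_distrib]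
      map_smul' := by intro r v; simp [Finset.mul_sum, mul_left_comm] }
  have hL : ∀ v ∈ Submodule.span ℂ (c '' (above : Set ι)), L v = 0 := by
    intro v hv
    refine Submodule.span_induction ?_ ?_ ?_ ?_ hv
    · rintro _ ⟨α, hα, rfl⟩
      exact hzero α hα
    · simp [L]
    · intro v w _ _ hv hw; rw [map_add, hv, hw, add_zero]
    · intro r v _ hv; rw [map_smul, hv, smul_zero]
  exact hne (hL _ hmem)

/-! ## Appendix B (NOT filed as a card; recorded for triage/plan) — peel to full support, then the Hadamard chain

Alternative architecture worked out by this ideator: reduce to the full-support case by slab/box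
peeling (glue `extremePoints_union_subset`), then prove thickness by the Hadamard-chain argument
(`chain_cube_lemma`, machine-checked: k-concentration of unital products over the Hadamard algebra
`ℂ^k`, cf. Agrawal–Saha–Saxena arXiv:1209.2333 §2.2–2.3).  Probably overlaps the co-filed card
`slab-recursion`; kept here so nothing is lost. -/

/-- Transfer statement of appendix B: the crux under the extra hypothesis that every `f i j` has
support EXACTLY `A j` (every letter alive in every term).  Appendix B reduces `DissociatedFixedK` to it
by slab/box peeling (`extremePoints_union_subset` + division by the alive term). -/
def FullSupportFixedK : Prop :=
  ∀ k : ℕ, ∃ C : ℕ, ∀ (m t : ℕ) (A : Fin m → Finset (Fin 2 →₀ ℕ))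
    (f : Fin k → Fin m → MvPolynomial (Fin 2) ℂ),
    (∀ j, (A j).card ≤ t) → (∀ i j, (f i j).support = A j) →
    (∀ a b : Fin m → (Fin 2 →₀ ℕ), (∀ j, a j ∈ A j) → (∀ j, b j ∈ A j) →
      ∑ j, a j = ∑ j, b j → a = b) →
    newtonVertexCount (∑ i, ∏ j, f i j) ≤ (m * t + 2) ^ C

/-- Appendix B lemma (cube lemma by the Hadamard chain, PROVED).  Full support lets one divide:
`u j i = c_ij(b_j) / c_ij(a_j)`, `x i = Π_j c_ij(a_j)`; the value of the tensor at the word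
"`a` with the coordinates in `T` switched to `b`" is `Σ_i x_i Π_{j∈T} u_{ji}`.  If all proper
switches are cancelled and the full switch survives then `s < k`: the `s+1` chain vectors
`e_r = u_0 ⊙ ⋯ ⊙ u_{r-1} ∈ ℂ^k` are dependent (`Module.exists_nontrivial_relation_of_finrank_lt_card`),
and multiplying the top relation by the remaining `u`'s writes `e_s` as a combination of
proper-switch vectors, all killed by `x`. -/
theorem chain_cube_lemma {k s : ℕ} (x : Fin k → ℂ) (u : Fin s → Fin k → ℂ)
    (hzero : ∀ T : Finset (Fin s), T ≠ Finset.univ → ∑ i, x i * ∏ j ∈ T, u j i = 0)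
    (htop : ∑ i, x i * ∏ j, u j i ≠ 0) : s < k := by
  classical
  by_contra hk
  push Not at hk
  -- chain vectors e_r = u_0 ⊙ ⋯ ⊙ u_{r-1}
  let e : Fin (s + 1) → (Fin k → ℂ) := fun r i =>
    ∏ j ∈ Finset.univ.filter (fun j : Fin s => j.val < r.val), u j i
  have hdep : ¬ LinearIndependent ℂ e := by
    intro hli
    have h := hli.fintype_card_le_finrank
    simp only [Fintype.card_fin, Module.finrank_fintype_fun_eq_card] at h
    omega
  obtain ⟨g, hg, hne⟩ := Fintype.not_linearIndependent_iff.1 hdep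
  -- maximal index with a nonzero coefficient
  let R : Finset (Fin (s + 1)) := Finset.univ.filter fun r => g r ≠ 0
  have hRne : R.Nonempty := by
    obtain ⟨r, hr⟩ := hne
    exact ⟨r, Finset.mem_filter.2 ⟨Finset.mem_univ _, hr⟩⟩
  set r0 := R.max' hRne with hr0def
  have hr0 : g r0 ≠ 0 := (Finset.mem_filter.1 (R.max'_mem hRne)).2
  have habove : ∀ r, r0 < r → g r = 0 := by
    intro r hr
    by_contra h
    have : r ≤ r0 := R.le_max' r (Finset.mem_filter.2 ⟨Finset.mem_univ _, h⟩)
    exact absurd hr (not_lt.2 this)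
  -- the tail u_{r0} ⊙ ⋯ ⊙ u_{s-1} and the functional L v = Σ_i x_i tail_i v_i
  let tail : Fin k → ℂ := fun i =>
    ∏ j ∈ Finset.univ.filter (fun j : Fin s => ¬ (j.val < r0.val)), u j i
  let L : (Fin k → ℂ) → ℂ := fun v => ∑ i, x i * tail i * v i
  -- L (e r0) is the full pairing
  have hLr0 : L (e r0) = ∑ i, x i * ∏ j, u j i := by
    refine Finset.sum_congr rfl fun i _ => ?_
    simp only [e, tail]
    rw [mul_assoc, mul_comm (∏ j ∈ Finset.univ.filter (fun j : Fin s => ¬ (j.val < r0.val)), u j i),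
      Finset.prod_filter_mul_prod_filter_not]
  -- L (e r) vanishes for r < r0 : a proper switch set
  have hLr : ∀ r, r < r0 → L (e r) = 0 := by
    intro r hr
    have hrs : r.val < s := by
      have h1 : r.val < r0.val := hr
      have h2 : r0.val ≤ s := Nat.lt_succ_iff.1 r0.2
      omega
    let T : Finset (Fin s) := Finset.univ.filter (fun j : Fin s => j.val < r.val) ∪
      Finset.univ.filter (fun j : Fin s => ¬ (j.val < r0.val))
    have hdisj : Disjoint (Finset.univ.filter (fun j : Fin s => j.val < r.val))
        (Finset.univ.filter (fun j : Fin s => ¬ (j.val < r0.val))) := by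
      rw [Finset.disjoint_filter]
      intro j _ h1 h2
      apply h2
      have : r.val < r0.val := hr
      omega
    have hT : T ≠ Finset.univ := by
      intro hTu
      have hmem : (⟨r.val, hrs⟩ : Fin s) ∈ T := by rw [hTu]; exact Finset.mem_univ _
      rcases Finset.mem_union.1 hmem with h | h
      · have := (Finset.mem_filter.1 h).2; simp at this
      · have := (Finset.mem_filter.1 h).2
        apply this
        exact hr
    have hval : L (e r) = ∑ i, x i * ∏ j ∈ T, u j i := by
      refine Finset.sum_congr rfl fun i _ => ?_
      simp only [e, tail, T]
      rw [Finset.prod_union hdisj, mul_assoc,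
        mul_comm (∏ j ∈ Finset.univ.filter (fun j : Fin s => ¬ (j.val < r0.val)), u j i)]
    rw [hval, hzero T hT]
  -- apply L to the relation Σ_r g_r • e_r = 0
  have hrel : ∑ r, g r * L (e r) = 0 := by
    have hpt : ∀ i, ∑ r, g r * e r i = 0 := by
      intro i
      have := congrFun hg i
      simpa [Finset.sum_apply, Pi.smul_apply, smul_eq_mul] using this
    have : ∑ r, g r * L (e r) = ∑ i, x i * tail i * ∑ r, g r * e r i := by
      simp only [L, Finset.mul_sum]
      rw [Finset.sum_comm]
      refine Finset.sum_congr rfl fun i _ => Finset.sum_congr rfl fun r _ => ?_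
      ring
    rw [this]
    exact Finset.sum_eq_zero fun i _ => by rw [hpt i, mul_zero]
  have hsingle : ∑ r, g r * L (e r) = g r0 * L (e r0) := by
    rw [Finset.sum_eq_single r0]
    · intro r _ hr
      rcases lt_or_gt_of_ne hr with h | h
      · rw [hLr r h, mul_zero]
      · rw [habove r h, zero_mul]
    · intro h; exact absurd (Finset.mem_univ _) h
  have : L (e r0) = 0 := by
    have h := hrel
    rw [hsingle] at h
    rcases mul_eq_zero.1 h with h | h
    · exact absurd h hr0
    · exact h
  exact htop (hLr0 ▸ this)


/-- Peeling glue of appendix B: a vertex of the hull of a union is a vertex of the hull of a piece. -/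
theorem extremePoints_union_subset {E : Type*} [AddCommGroup E] [Module ℝ E] (S₁ S₂ : Set E) :
    Set.extremePoints ℝ (convexHull ℝ (S₁ ∪ S₂))
      ⊆ Set.extremePoints ℝ (convexHull ℝ S₁) ∪ Set.extremePoints ℝ (convexHull ℝ S₂) := by
  intro x hx
  have hxS : x ∈ S₁ ∪ S₂ := extremePoints_convexHull_subset hx
  rcases hxS with h | h
  · left
    exact inter_extremePoints_subset_extremePoints_of_subset
      (convexHull_mono Set.subset_union_left) ⟨subset_convexHull ℝ _ h, hx⟩
  · right
    exact inter_extremePoints_subset_extremePoints_of_subset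
      (convexHull_mono Set.subset_union_right) ⟨subset_convexHull ℝ _ h, hx⟩

/-! ## Shared planar wrapper (cards C and A) -/

/-- Expansion of a product over a frame into monomials indexed by frame words. -/
theorem prod_eq_sum_monomial {m : ℕ} (A : Fin m → Finset (Fin 2 →₀ ℕ))
    (g : Fin m → MvPolynomial (Fin 2) ℂ) (hg : ∀ j, (g j).support ⊆ A j) :
    ∏ j, g j = ∑ b ∈ Fintype.piFinset A,
      MvPolynomial.monomial (∑ j, b j) (∏ j, MvPolynomial.coeff (b j) (g j)) := by
  classical
  have hexp : ∀ j, g j = ∑ e ∈ A j, MvPolynomial.monomial e (MvPolynomial.coeff e (g j)) := by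
    intro j
    conv_lhs => rw [MvPolynomial.as_sum (g j)]
    apply Finset.sum_subset (hg j)
    intro e _ he
    rw [MvPolynomial.notMem_support_iff.1 he, map_zero]
  rw [show (∏ j, g j) = ∏ j, ∑ e ∈ A j, MvPolynomial.monomial e (MvPolynomial.coeff e (g j)) from
    Finset.prod_congr rfl (fun j _ => hexp j)]
  rw [Finset.prod_univ_sum]
  refine Finset.sum_congr rfl fun b _ => ?_
  rw [MvPolynomial.monomial_sum_prod]

theorem coeff_prod_of_injective {m : ℕ} (A : Fin m → Finset (Fin 2 →₀ ℕ))
    (g : Fin m → MvPolynomial (Fin 2) ℂ) (hg : ∀ j, (g j).support ⊆ A j)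
    (hinj : ∀ a b : Fin m → (Fin 2 →₀ ℕ), (∀ j, a j ∈ A j) → (∀ j, b j ∈ A j) →
      ∑ j, a j = ∑ j, b j → a = b)
    (a : Fin m → (Fin 2 →₀ ℕ)) (ha : ∀ j, a j ∈ A j) :
    MvPolynomial.coeff (∑ j, a j) (∏ j, g j) = ∏ j, MvPolynomial.coeff (a j) (g j) := by
  classical
  rw [prod_eq_sum_monomial A g hg, MvPolynomial.coeff_sum]
  simp only [MvPolynomial.coeff_monomial]
  rw [Finset.sum_eq_single a]
  · simp
  · intro b hb hba
    rw [if_neg]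
    intro heq
    apply hba
    exact hinj b a (fun j => (Fintype.mem_piFinset.1 hb) j) ha heq
  · intro hna
    exact absurd (Fintype.mem_piFinset.2 ha) hna

/-- Coefficient formula on a dissociated frame: the coefficient of `Σ_i Π_j f_ij` at the point
`Σ_j a_j` of the frame is the value `T(a) = Σ_i Π_j coeff_{a_j} f_ij` of the coefficient tensor.  PROVED (with `prod_eq_sum_monomial`, `coeff_prod_of_injective`, `support_sum_prod_subset`). -/
theorem coeff_sum_prod_of_injective {k m : ℕ} (A : Fin m → Finset (Fin 2 →₀ ℕ))
    (f : Fin k → Fin m → MvPolynomial (Fin 2) ℂ) (hf : ∀ i j, (f i j).support ⊆ A j)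
    (hinj : ∀ a b : Fin m → (Fin 2 →₀ ℕ), (∀ j, a j ∈ A j) → (∀ j, b j ∈ A j) →
      ∑ j, a j = ∑ j, b j → a = b)
    (a : Fin m → (Fin 2 →₀ ℕ)) (ha : ∀ j, a j ∈ A j) :
    MvPolynomial.coeff (∑ j, a j) (∑ i, ∏ j, f i j) = ∑ i, ∏ j, MvPolynomial.coeff (a j) (f i j) := by
  rw [MvPolynomial.coeff_sum]
  exact Finset.sum_congr rfl fun i _ => coeff_prod_of_injective A (f i) (hf i) hinj a ha

/-- Support containment: every monomial of `Σ_i Π_j f_ij` is a frame point (no injectivity needed). -/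
theorem support_sum_prod_subset {k m : ℕ} (A : Fin m → Finset (Fin 2 →₀ ℕ))
    (f : Fin k → Fin m → MvPolynomial (Fin 2) ℂ) (hf : ∀ i j, (f i j).support ⊆ A j) :
    (∑ i, ∏ j, f i j).support ⊆ (Fintype.piFinset A).image (fun a => ∑ j, a j) := by
  classical
  intro e he
  obtain ⟨i, _, hi⟩ := Finset.mem_biUnion.1 (MvPolynomial.support_sum he)
  rw [prod_eq_sum_monomial A (f i) (hf i)] at hi
  obtain ⟨b, hb, hbe⟩ := Finset.mem_biUnion.1 (MvPolynomial.support_sum hi)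
  have := MvPolynomial.support_monomial_subset hbe
  rw [Finset.mem_singleton] at this
  exact Finset.mem_image.2 ⟨b, hb, this.symm⟩

/-- A continuous linear functional on `Fin 2 → ℝ` is a dot product. -/
theorem exists_vec_of_clm (f : (Fin 2 → ℝ) →L[ℝ] ℝ) : ∃ w : Fin 2 → ℝ, ∀ p, f p = w ⬝ᵥ p := by
  refine ⟨fun i => f (fun j => if i = j then 1 else 0), fun p => ?_⟩
  have h := (f : (Fin 2 → ℝ) →ₗ[ℝ] ℝ).pi_apply_eq_sum_univ p
  simp only [ContinuousLinearMap.coe_coe] at h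
  rw [h]
  simp only [dotProduct, smul_eq_mul]
  refine Finset.sum_congr rfl fun i _ => ?_
  ring

/-- Strict exposure of a vertex of the hull of a finite planar set. -/
theorem exists_strict_sep (S : Finset (Fin 2 → ℝ)) {v : Fin 2 → ℝ}
    (hv : v ∈ Set.extremePoints ℝ (convexHull ℝ (S : Set (Fin 2 → ℝ)))) :
    ∃ w : Fin 2 → ℝ, ∀ p ∈ S, p ≠ v → w ⬝ᵥ p < w ⬝ᵥ v := by
  have hnot : v ∉ convexHull ℝ ((S : Set (Fin 2 → ℝ)) \ {v}) := by
    have h := ((convex_convexHull ℝ (S : Set (Fin 2 → ℝ))).mem_extremePoints_iff_mem_sdiff_convexHull_sdiff).1 hv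
    intro hmem
    apply h.2
    exact convexHull_mono (Set.sdiff_subset_sdiff_left (subset_convexHull ℝ _)) hmem
  have hfin : ((S : Set (Fin 2 → ℝ)) \ {v}).Finite := S.finite_toSet.sdiff
  have hclosed : IsClosed (convexHull ℝ ((S : Set (Fin 2 → ℝ)) \ {v})) := hfin.isClosed_convexHull ℝ
  obtain ⟨f, u, hfu, hub⟩ := geometric_hahn_banach_point_closed (convex_convexHull ℝ _) hclosed hnot
  obtain ⟨w, hw⟩ := exists_vec_of_clm f
  refine ⟨-w, fun p hp hpv => ?_⟩
  have hp' : u < f p := hub p (subset_convexHull ℝ _ ⟨hp, hpv⟩)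
  rw [hw] at hfu hp'
  simp only [neg_dotProduct]
  linarith

/-- A direction whose dot product is injective on a finite planar set. -/
theorem exists_inj_dir (U : Finset (Fin 2 → ℝ)) :
    ∃ d : Fin 2 → ℝ, Set.InjOn (fun p => d ⬝ᵥ p) (U : Set (Fin 2 → ℝ)) := by
  classical
  let bad : Finset ℝ := (U ×ˢ U).image fun pq => -((pq.1 - pq.2) 0) / ((pq.1 - pq.2) 1)
  obtain ⟨θ, hθ⟩ := Infinite.exists_notMem_finset bad
  refine ⟨![1, θ], fun p hp q hq hpq => ?_⟩
  have hpq' : ![1, θ] ⬝ᵥ p = ![1, θ] ⬝ᵥ q := hpq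
  by_contra hne
  have h1 : (p - q) 0 + θ * (p - q) 1 = 0 := by
    have h0 : ![1, θ] ⬝ᵥ (p - q) = 0 := by rw [dotProduct_sub, hpq', sub_self]
    simpa [dotProduct, Fin.sum_univ_two] using h0
  by_cases h2 : (p - q) 1 = 0
  · have h0 : (p - q) 0 = 0 := by rw [h2, mul_zero, add_zero] at h1; exact h1
    apply hne
    funext i
    fin_cases i
    · exact sub_eq_zero.1 h0
    · exact sub_eq_zero.1 h2
  · apply hθ
    refine Finset.mem_image.2 ⟨(p, q), Finset.mem_product.2 ⟨hp, hq⟩, ?_⟩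
    show -((p - q) 0) / ((p - q) 1) = θ
    field_simp
    linarith

/-- Exposed direction: a vertex of the hull of a finite planar set is the STRICT maximiser of a
linear functional which moreover takes distinct values on any prescribed finite set `U` (here:
the whole frame image), so that the induced order on words is strict.
(`Convex.mem_extremePoints_iff_mem_sdiff_convexHull_sdiff` + `geometric_hahn_banach_point_closed`
+ a perturbation.)  PROVED. -/
theorem exists_strict_direction (S U : Finset (Fin 2 → ℝ)) {v : Fin 2 → ℝ}
    (hv : v ∈ Set.extremePoints ℝ (convexHull ℝ (S : Set (Fin 2 → ℝ)))) :
    ∃ w : Fin 2 → ℝ, (∀ p ∈ S, p ≠ v → ∑ i, w i * p i < ∑ i, w i * v i) ∧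
      Set.InjOn (fun p : Fin 2 → ℝ => ∑ i, w i * p i) (U : Set (Fin 2 → ℝ)) := by
  classical
  obtain ⟨w₀, hw₀⟩ := exists_strict_sep S hv
  obtain ⟨d, hd⟩ := exists_inj_dir U
  -- a uniform bound on |d ⬝ (p - v)| over S
  set M : ℝ := 1 + ∑ p ∈ S, |d ⬝ᵥ (p - v)| with hM
  have hMpos : 0 < M := by
    have : 0 ≤ ∑ p ∈ S, |d ⬝ᵥ (p - v)| := Finset.sum_nonneg fun p _ => abs_nonneg _
    linarith
  have hMbound : ∀ p ∈ S, d ⬝ᵥ (p - v) ≤ M := by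
    intro p hp
    have h1 : d ⬝ᵥ (p - v) ≤ |d ⬝ᵥ (p - v)| := le_abs_self _
    have h2 : |d ⬝ᵥ (p - v)| ≤ ∑ q ∈ S, |d ⬝ᵥ (q - v)| :=
      Finset.single_le_sum (f := fun q => |d ⬝ᵥ (q - v)|) (fun q _ => abs_nonneg _) hp
    linarith
  -- a positive lower bound g₀ on the gaps
  obtain ⟨g₀, hg₀pos, hg₀⟩ : ∃ g₀ : ℝ, 0 < g₀ ∧ ∀ p ∈ S, p ≠ v → g₀ ≤ w₀ ⬝ᵥ v - w₀ ⬝ᵥ p := by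
    by_cases hne : (S.erase v).Nonempty
    · obtain ⟨p₀, hp₀, hmin⟩ := Finset.exists_min_image (S.erase v) (fun p => w₀ ⬝ᵥ v - w₀ ⬝ᵥ p) hne
      refine ⟨w₀ ⬝ᵥ v - w₀ ⬝ᵥ p₀, ?_, fun p hp hpv => hmin p (Finset.mem_erase.2 ⟨hpv, hp⟩)⟩
      have := hw₀ p₀ (Finset.mem_of_mem_erase hp₀) (Finset.ne_of_mem_erase hp₀)
      linarith
    · refine ⟨1, one_pos, fun p hp hpv => ?_⟩
      exact absurd ⟨p, Finset.mem_erase.2 ⟨hpv, hp⟩⟩ hne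
  -- bad ε's for injectivity
  let bad : Finset ℝ := (U ×ˢ U).image fun pq => -(w₀ ⬝ᵥ (pq.1 - pq.2)) / (d ⬝ᵥ (pq.1 - pq.2))
  have hIoo : (Set.Ioo (0 : ℝ) (g₀ / M)).Infinite := Set.Ioo_infinite (div_pos hg₀pos hMpos)
  obtain ⟨ε, hεI, hεbad⟩ := hIoo.exists_notMem_finset bad
  obtain ⟨hε0, hε1⟩ := hεI
  refine ⟨w₀ + ε • d, ?_, ?_⟩
  · intro p hp hpv
    have hgap := hg₀ p hp hpv
    have hb := hMbound p hp
    have key : ε * (d ⬝ᵥ (p - v)) < g₀ := by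
      have h1 : ε * (d ⬝ᵥ (p - v)) ≤ ε * M := mul_le_mul_of_nonneg_left hb hε0.le
      have h2 : ε * M < g₀ := by rwa [lt_div_iff₀ hMpos] at hε1
      linarith
    have e1 : ∑ i, (w₀ + ε • d) i * p i = w₀ ⬝ᵥ p + ε * (d ⬝ᵥ p) := by
      simp only [dotProduct, Pi.add_apply, Pi.smul_apply, smul_eq_mul, Finset.mul_sum, ← Finset.sum_add_distrib]
      refine Finset.sum_congr rfl fun i _ => ?_; ring
    have e2 : ∑ i, (w₀ + ε • d) i * v i = w₀ ⬝ᵥ v + ε * (d ⬝ᵥ v) := by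
      simp only [dotProduct, Pi.add_apply, Pi.smul_apply, smul_eq_mul, Finset.mul_sum, ← Finset.sum_add_distrib]
      refine Finset.sum_congr rfl fun i _ => ?_; ring
    rw [e1, e2]
    have e3 : d ⬝ᵥ (p - v) = d ⬝ᵥ p - d ⬝ᵥ v := dotProduct_sub d p v
    rw [e3] at key
    nlinarith
  · intro p hp q hq hpq
    have hpq' : ∑ i, (w₀ + ε • d) i * p i = ∑ i, (w₀ + ε • d) i * q i := hpq
    by_contra hne
    have hdne : d ⬝ᵥ (p - q) ≠ 0 := by
      intro h0
      apply hne
      apply hd hp hq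
      show d ⬝ᵥ p = d ⬝ᵥ q
      have := dotProduct_sub d p q
      linarith
    have hsum : w₀ ⬝ᵥ (p - q) + ε * (d ⬝ᵥ (p - q)) = 0 := by
      have e : ∀ r : Fin 2 → ℝ, ∑ i, (w₀ + ε • d) i * r i = w₀ ⬝ᵥ r + ε * (d ⬝ᵥ r) := by
        intro r
        simp only [dotProduct, Pi.add_apply, Pi.smul_apply, smul_eq_mul, Finset.mul_sum, ← Finset.sum_add_distrib]
        refine Finset.sum_congr rfl fun i _ => ?_; ring
      rw [e p, e q] at hpq'
      rw [dotProduct_sub, dotProduct_sub]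
      linarith
    apply hεbad
    refine Finset.mem_image.2 ⟨(p, q), Finset.mem_product.2 ⟨hp, hq⟩, ?_⟩
    show -(w₀ ⬝ᵥ (p - q)) / (d ⬝ᵥ (p - q)) = ε
    field_simp
    linarith


/-- Shape of the target, for the record: the crux decl itself (never restated by the cards). -/
example : Summit.ValiantsHypothesis.ValiantsHypothesis.Theses.NewtonUnitEquations.DissociatedFixedK
    = ∀ k : ℕ, ∃ C : ℕ, ∀ (m t : ℕ) (A : Fin m → Finset (Fin 2 →₀ ℕ))
      (f : Fin k → Fin m → MvPolynomial (Fin 2) ℂ), (∀ j, (A j).card ≤ t) →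
      (∀ i j, (f i j).support ⊆ A j) →
      (∀ a b : Fin m → (Fin 2 →₀ ℕ), (∀ j, a j ∈ A j) → (∀ j, b j ∈ A j) →
        ∑ j, a j = ∑ j, b j → a = b) →
      newtonVertexCount (∑ i, ∏ j, f i j) ≤ (m * t + 2) ^ C := rfl

/-- The transfer of appendix B is a special case of the crux (sanity). -/
theorem fullSupport_of_crux
    (h : Summit.ValiantsHypothesis.ValiantsHypothesis.Theses.NewtonUnitEquations.DissociatedFixedK) :
    FullSupportFixedK := by
  intro k
  obtain ⟨C, hC⟩ := h k
  exact ⟨C, fun m t A f hA hf hinj => hC m t A f hA (fun i j => (hf i j).le) hinj⟩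

end

end Summit.ValiantsHypothesis.ValiantsHypothesis.Cruxes.DissociatedFixedK.Ideator3
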